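import Summits.ResolutionOfSingularities.ResolutionOfSingularities.Theorems.FrobeniusClosingSteerCurveEscape
import HarnessLib

/-!
# Crux `Steer` (stmt-ResolutionOfSingularities-16345), chain W4.1, σ-residual SUPPORT: **CurveEscape, SEED form**
# (helper γ, additive sibling of parts 1–2; Theses-free, def-free)

OURS (campaign `res-hironaka`, rung L ★L-G4, slot W4.1; a statement about the route's own objects — sequences of
quadratic transforms of local rings along a valuation ring (`Resolution.IsQuadraticTransformAlong`,
`QuadraticTransforms.lean`); it replaces the role of no printed item and is NOT a statement of the manuscript under
review [claim: Hironaka2017, status: under-review]; AI review is weaker than expert review). Own-file after-care of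
ORDER γ of res-L0-w41-plan-1 (HOME/STATUS 2026-08-27T06:15:18Z) by the seat of record res-type-038: the two landed
statements `curveEscape` / `curveEscapeBound(_lt)` (`FrobeniusClosingSteerCurveEscape.lean`) assume that the residue
ring `R i ⧸ P i` of the followed curve is regular of dimension one AT EVERY STAGE `i`; here that hypothesis is
weakened to ONE stage (a "seed"), as suggested by res-type-071's quotient-free INPUT (HOME/INBOX 2026-08-27T06:34:10Z).

## What is proved

ONE STEP `R → R'` along `O` (exceptional parameter `x`, primes `P' ∩ R = P ≠ 𝔪_R`): `exists_mul_inclusion_eq`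
(every `r' ∈ R'` satisfies `r'·s = t` with `s, t ∈ R`, `s ∉ P`); `quotientMap_injective` / `quotientMap_surjective`
(the residue map `R ⧸ P → R' ⧸ P'` is injective by the contraction clause and, when `O` dominates `R` and `R ⧸ P` is
a valuation ring, surjective = part 1's lifting lemma `exists_sub_inclusion_mem`); hence `valuationRing_quotient_step`,
`isRegularLocalRing_quotient_step` (Mathlib `Function.Surjective.valuationRing`, `IsRegularLocalRing.of_ringEquiv`,
`ringKrullDim_eq_of_ringEquiv`). KEY REMARK 2 `subringDominates_of_isRegularLocalRing_quotient`: if `R ⧸ P` is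
regular of dimension one and the curve is still followed one step later (`P' ≠ 𝔪_{R'}`), then `O` dominates `R`
AUTOMATICALLY. ALONG THE SEQUENCE: `valuationRing_quotient_of_seed`, `isRegularLocalRing_quotient_of_seed`.
THE STATEMENTS, SEED FORM (by reduction to the landed `curveEscape` / `curveEscapeBound_lt`; no new valuation
argument): `curveEscapeBound_lt_seed` / `curveEscapeBound_seed` (`IsRegularLocalRing (R 0 ⧸ P 0) ∧ ringKrullDim = 1`
in place of the clause «for all `i < N`»; core `curveEscapeBound_lt_of_valuationRing` with the weakest hypothesis
`ValuationRing (R 0 ⧸ P 0)`), and `curveEscape_seed` («`∃ i₀`, `R i₀ ⧸ P i₀` regular of dimension one» in place of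
«`∀ i`», `P 0 ≠ ⊥` in place of «`∀ i, P i ≠ ⊥`»).

Def-free, sorry-free; imports part 2 only. Consumers as for ORDER γ (res-L0-k41 / strat-2 K4.1f engine sanity A6 —
the regularity of the hosting curve needs checking at the START of the window only; idea-3 PT₁ / G2; tri-3 ALT₁).
-/

noncomputable section

set_option linter.dupNamespace false

namespace Summit.ResolutionOfSingularities.ResolutionOfSingularities.Theorems.SwitchingDichotomy.CurveEscape

open IsLocalRing Literature.AlgebraicGeometry.Resolution

universe u

variable {K : Type u} [Field K]

/-! ## §4 Generalities: units modulo a proper ideal of a local ring -/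

/-- In a local ring, an element which is a unit modulo a proper ideal is a unit. OURS bookkeeping. [folklore] -/
theorem isUnit_of_isUnit_mk {S : Type*} [CommRing S] [IsLocalRing S] {I : Ideal S} (hI : I ≠ ⊤) {a : S}
    (hu : IsUnit (Ideal.Quotient.mk I a)) : IsUnit a := by
  obtain ⟨q, hq⟩ := hu.exists_right_inv
  obtain ⟨b, rfl⟩ := Ideal.Quotient.mk_surjective q
  rw [← map_mul, ← map_one (Ideal.Quotient.mk I), Ideal.Quotient.eq] at hq
  have h1 : IsUnit (a * b) := by
    apply IsLocalRing.isUnit_of_mem_nonunits_one_sub_self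
    have h2 : (1 : S) - a * b = -(a * b - 1) := by ring
    rw [h2]
    exact (IsLocalRing.mem_maximalIdeal _).mp (IsLocalRing.le_maximalIdeal hI (I.neg_mem hq))
  exact isUnit_of_mul_isUnit_left h1

/-! ## §5 One step `R → R'`: the residue rings `R ⧸ P → R' ⧸ P'` of the strict transform -/

section OneStepSeed

variable {O : ValuationSubring K} {R R' : Subring K} [IsLocalRing R] [IsLocalRing R']

/-- **Fraction decomposition**: every `r' ∈ R' = (R[𝔪_R/x])_{𝔪_O ∩ R[𝔪_R/x]}` satisfies `r'·s = t` with
`s, t ∈ R` and `s ∉ P` (`r' = y/z`, `v z = 1`, `y x^N = a`, `z x^M = b`; `s := b x^N`, `t := a x^M`; `s ∉ P`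
because `z` is a unit of `R'` and `x ∉ P'`). OURS bookkeeping (extracted from part 1's lifting lemma). [folklore] -/
theorem exists_mul_inclusion_eq (h : IsQuadraticTransformAlong O R R') {x : R} (hx0 : x ≠ 0)
    (hR' : R' = locAtCentre (blowupRing R (x : K)) O) {P : Ideal R} {P' : Ideal R'} [P'.IsPrime]
    (hP : P ≠ maximalIdeal R) (hc : P'.comap (Subring.inclusion h.le) = P) (r' : R') :
    ∃ s t : R, s ∉ P ∧ r' * Subring.inclusion h.le s = Subring.inclusion h.le t := by
  classical
  have hx0' : (x : K) ≠ 0 := fun e => hx0 (Subtype.ext e)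
  have hr' : (r' : K) ∈ locAtCentre (blowupRing R (x : K)) O := hR' ▸ r'.2
  obtain ⟨y, hy, z, hz, hvz, hyz⟩ := mem_locAtCentre_iff.mp hr'
  obtain ⟨N, a, ha⟩ := exists_mul_pow_eq_of_mem_blowupRing hx0' hy
  obtain ⟨M, b, hb⟩ := exists_mul_pow_eq_of_mem_blowupRing hx0' hz
  have hz0 : z ≠ 0 := ne_zero_of_valuation_eq_one hvz
  have hst : (r' : K) * ((b : K) * (x : K) ^ N) = (a : K) * (x : K) ^ M := by
    rw [← ha, ← hb, hyz]
    field_simp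
  have hzR' : z ∈ R' := hR' ▸ le_locAtCentre _ O hz
  have hzunit : IsUnit (⟨z, hzR'⟩ : R') := isUnit_of_valuation_eq_one h hvz
  refine ⟨b * x ^ N, a * x ^ M, ?_, ?_⟩
  · intro hs
    have h1 : Subring.inclusion h.le (b * x ^ N) ∈ P' := by rw [← Ideal.mem_comap, hc]; exact hs
    have h2 : Subring.inclusion h.le (b * x ^ N) = ⟨z, hzR'⟩ * (Subring.inclusion h.le x) ^ (M + N) := by
      apply Subtype.ext
      simp only [Subring.coe_mul, Subring.coe_pow, Subring.coe_inclusion]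
      rw [← hb]
      ring
    rw [h2] at h1
    rcases Ideal.IsPrime.mem_or_mem ‹_› h1 with h3 | h3
    · exact Ideal.IsPrime.ne_top ‹_› (Ideal.eq_top_of_isUnit_mem _ h3 hzunit)
    · exact not_mem_of_comap_eq h hx0 hR' hP hc (Ideal.IsPrime.mem_of_pow_mem ‹_› _ h3)
  · apply Subtype.ext
    simp only [Subring.coe_mul, Subring.coe_pow, Subring.coe_inclusion]
    exact hst

omit [IsLocalRing R] [IsLocalRing R'] in
/-- **The residue map `R ⧸ P → R' ⧸ P'` is injective** (`P' ∩ R = P`). OURS bookkeeping. [folklore] -/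
theorem quotientMap_injective (h : IsQuadraticTransformAlong O R R') {P : Ideal R} {P' : Ideal R'}
    (hc : P'.comap (Subring.inclusion h.le) = P) :
    Function.Injective (Ideal.quotientMap P' (Subring.inclusion h.le) hc.ge) :=
  Ideal.quotientMap_injective' hc.le

/-- **The residue map `R ⧸ P → R' ⧸ P'` is surjective** when `O` dominates `R` and `R ⧸ P` is a valuation ring
(part 1's lifting lemma `exists_sub_inclusion_mem`). OURS. [folklore] -/
theorem quotientMap_surjective (h : IsQuadraticTransformAlong O R R') (hRO : SubringDominates R O.toSubring)
    {x : R} (hx0 : x ≠ 0) (hR' : R' = locAtCentre (blowupRing R (x : K)) O) {P : Ideal R} {P' : Ideal R'}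
    [P.IsPrime] [P'.IsPrime] (hP : P ≠ maximalIdeal R) (hc : P'.comap (Subring.inclusion h.le) = P)
    [ValuationRing (R ⧸ P)] :
    Function.Surjective (Ideal.quotientMap P' (Subring.inclusion h.le) hc.ge) := by
  intro q
  obtain ⟨r', rfl⟩ := Ideal.Quotient.mk_surjective q
  obtain ⟨r, hr⟩ := exists_sub_inclusion_mem h hRO hx0 hR' hP hc r'
  refine ⟨Ideal.Quotient.mk P r, ?_⟩
  rw [Ideal.quotientMap_mk, Ideal.Quotient.eq]
  have h1 := P'.neg_mem hr
  rwa [neg_sub] at h1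

/-- **`ValuationRing` passes from `R ⧸ P` to `R' ⧸ P'`** (surjective residue map onto a domain; Mathlib
`Function.Surjective.valuationRing`). OURS. [folklore] -/
theorem valuationRing_quotient_step (h : IsQuadraticTransformAlong O R R')
    (hRO : SubringDominates R O.toSubring) {x : R} (hx0 : x ≠ 0)
    (hR' : R' = locAtCentre (blowupRing R (x : K)) O) {P : Ideal R} {P' : Ideal R'} [P.IsPrime] [P'.IsPrime]
    (hP : P ≠ maximalIdeal R) (hc : P'.comap (Subring.inclusion h.le) = P) (hval : ValuationRing (R ⧸ P)) :
    ValuationRing (R' ⧸ P') :=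
  haveI := hval
  Function.Surjective.valuationRing _ (quotientMap_surjective h hRO hx0 hR' hP hc)

/-- **Regularity of dimension one passes from `R ⧸ P` to `R' ⧸ P'`**: a regular local ring of dimension one
is a valuation ring, so the residue map is a ring isomorphism `R ⧸ P ≃+* R' ⧸ P'` (Mathlib
`IsRegularLocalRing.of_ringEquiv`, `ringKrullDim_eq_of_ringEquiv`). OURS. [folklore] -/
theorem isRegularLocalRing_quotient_step (h : IsQuadraticTransformAlong O R R')
    (hRO : SubringDominates R O.toSubring) {x : R} (hx0 : x ≠ 0)
    (hR' : R' = locAtCentre (blowupRing R (x : K)) O) {P : Ideal R} {P' : Ideal R'} [P.IsPrime] [P'.IsPrime]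
    (hP : P ≠ maximalIdeal R) (hc : P'.comap (Subring.inclusion h.le) = P)
    (hreg : IsRegularLocalRing (R ⧸ P)) (hdim : ringKrullDim (R ⧸ P) = 1) :
    IsRegularLocalRing (R' ⧸ P') ∧ ringKrullDim (R' ⧸ P') = 1 := by
  haveI := hreg
  haveI := isPrincipalIdealRing_of_ringKrullDim_le_one (R := R ⧸ P) hdim.le
  haveI : ValuationRing (R ⧸ P) := inferInstance
  let e : (R ⧸ P) ≃+* (R' ⧸ P') :=
    RingEquiv.ofBijective (Ideal.quotientMap P' (Subring.inclusion h.le) hc.ge)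
      ⟨quotientMap_injective h hc, quotientMap_surjective h hRO hx0 hR' hP hc⟩
  refine ⟨IsRegularLocalRing.of_ringEquiv e, ?_⟩
  rw [← ringKrullDim_eq_of_ringEquiv e]
  exact hdim

/-- **KEY REMARK 2 — domination of the seed ring is automatic.** If `R ⧸ P` is regular of dimension one (a
discrete valuation ring) and the curve is still followed after the step (`P' ≠ 𝔪_{R'}`), then `O` dominates `R`:
a non-unit `y` of `R` with `y⁻¹ ∈ O` is a unit of `R'` (domination of `R'`), is prime to `P` (else `P' = ⊤`), so
`ȳ ~ ϖⁿ` with `n ≥ 1` makes the uniformiser `ϖ` of `R ⧸ P` a unit modulo `P'`; then every `t ∈ R ∖ P` is a unit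
modulo `P'`, and the fraction decomposition `r''·s = t` (`s ∉ P`) puts every `r'' ∈ 𝔪_{R'}` into `P'` — so
`P' = 𝔪_{R'}`, a contradiction. OURS. [folklore] -/
theorem subringDominates_of_isRegularLocalRing_quotient (h : IsQuadraticTransformAlong O R R') {x : R}
    (hx0 : x ≠ 0) (hR' : R' = locAtCentre (blowupRing R (x : K)) O) {P : Ideal R} {P' : Ideal R'}
    [P.IsPrime] [P'.IsPrime] (hP : P ≠ maximalIdeal R) (hP' : P' ≠ maximalIdeal R')
    (hc : P'.comap (Subring.inclusion h.le) = P)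
    (hreg : IsRegularLocalRing (R ⧸ P)) (hdim : ringKrullDim (R ⧸ P) = 1) :
    SubringDominates R O.toSubring := by
  classical
  haveI := hreg
  haveI := isPrincipalIdealRing_of_ringKrullDim_le_one (R := R ⧸ P) hdim.le
  -- `R ⧸ P` is a discrete valuation ring
  have hnf : maximalIdeal (R ⧸ P) ≠ ⊥ := by
    intro hbot
    apply hP
    have hfield : IsField (R ⧸ P) := (IsLocalRing.isField_iff_maximalIdeal_eq).mpr hbot
    exact IsLocalRing.eq_maximalIdeal (Ideal.Quotient.maximal_of_isField P hfield)
  haveI : IsDiscreteValuationRing (R ⧸ P) := { not_a_field' := hnf }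
  obtain ⟨ϖ, hϖ⟩ := IsDiscreteValuationRing.exists_irreducible (R ⧸ P)
  -- the residue map `f : R ⧸ P → R' ⧸ P'`
  set f := Ideal.quotientMap P' (Subring.inclusion h.le) hc.ge with hf
  refine ⟨h.source_le, fun y hy hyO => ?_⟩
  by_contra hyR
  have hy0 : y ≠ 0 := by rintro rfl; exact hyR (by rw [inv_zero]; exact R.zero_mem)
  have hy𝔪 : (⟨y, hy⟩ : R) ∈ maximalIdeal R := (mem_maximalIdeal_iff_inv_not_mem _).mpr (Or.inr hyR)
  -- `y` is a unit of `R'` (domination of `R'` by `O`)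
  have hyunit : IsUnit (Subring.inclusion h.le ⟨y, hy⟩) := by
    rw [isUnit_subring_iff_inv_mem]
    exact ⟨hy0, h.dominated.2 y (h.le hy) hyO⟩
  -- `y ∉ P`
  have hyP : (⟨y, hy⟩ : R) ∉ P := fun hyP => by
    have h1 : Subring.inclusion h.le ⟨y, hy⟩ ∈ P' := by rw [← Ideal.mem_comap, hc]; exact hyP
    exact Ideal.IsPrime.ne_top ‹_› (Ideal.eq_top_of_isUnit_mem _ h1 hyunit)
  have hybar0 : Ideal.Quotient.mk P ⟨y, hy⟩ ≠ 0 := by rw [Ne, Ideal.Quotient.eq_zero_iff_mem]; exact hyP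
  have hybar : ¬ IsUnit (Ideal.Quotient.mk P ⟨y, hy⟩) := fun hu =>
    (IsLocalRing.mem_maximalIdeal _).mp hy𝔪 (isUnit_of_isUnit_mk (Ideal.IsPrime.ne_top ‹_›) hu)
  -- the uniformiser becomes a unit modulo `P'`
  obtain ⟨n, hn⟩ := IsDiscreteValuationRing.associated_pow_irreducible hybar0 hϖ
  have hn0 : n ≠ 0 := by
    rintro rfl
    rw [pow_zero] at hn
    exact hybar (hn.symm.isUnit isUnit_one)
  have hfy : IsUnit (f (Ideal.Quotient.mk P ⟨y, hy⟩)) := by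
    rw [hf, Ideal.quotientMap_mk]
    exact hyunit.map _
  have hfϖ : IsUnit (f ϖ) := by
    have h1 : IsUnit (f (ϖ ^ n)) := (hn.map f).isUnit hfy
    rw [map_pow] at h1
    exact (isUnit_pow_iff hn0).mp h1
  -- every element of `R ∖ P` is a unit modulo `P'`
  have hunitP : ∀ t : R, t ∉ P → IsUnit (Ideal.Quotient.mk P' (Subring.inclusion h.le t)) := by
    intro t ht
    have ht0 : Ideal.Quotient.mk P t ≠ 0 := by rw [Ne, Ideal.Quotient.eq_zero_iff_mem]; exact ht
    obtain ⟨m, hm⟩ := IsDiscreteValuationRing.associated_pow_irreducible ht0 hϖ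
    have h1 : IsUnit (f (ϖ ^ m)) := by rw [map_pow]; exact hfϖ.pow m
    have h2 : IsUnit (f (Ideal.Quotient.mk P t)) := (hm.map f).symm.isUnit h1
    rwa [hf, Ideal.quotientMap_mk] at h2
  -- hence `𝔪_{R'} ≤ P'`: contradiction with `P' ≠ 𝔪_{R'}`
  apply hP'
  refine le_antisymm (IsLocalRing.le_maximalIdeal (Ideal.IsPrime.ne_top ‹_›)) fun r'' hr'' => ?_
  obtain ⟨s, t, hsP, hst⟩ := exists_mul_inclusion_eq h hx0 hR' hP hc r''
  by_cases htP : t ∈ P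
  · have h1 : r'' * Subring.inclusion h.le s ∈ P' := by rw [hst, ← Ideal.mem_comap, hc]; exact htP
    rcases Ideal.IsPrime.mem_or_mem ‹_› h1 with h2 | h2
    · exact h2
    · rw [← Ideal.mem_comap, hc] at h2
      exact absurd h2 hsP
  · exfalso
    have h1 : IsUnit (Ideal.Quotient.mk P' (r'' * Subring.inclusion h.le s)) := by rw [hst]; exact hunitP t htP
    have h2 : IsUnit (r'' * Subring.inclusion h.le s) := isUnit_of_isUnit_mk (Ideal.IsPrime.ne_top ‹_›) h1
    exact (IsLocalRing.mem_maximalIdeal _).mp hr'' (isUnit_of_mul_isUnit_left h2)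

end OneStepSeed

/-! ## §6 Along the sequence: propagation of the residue ring of the seed -/

section SequenceSeed

variable {O : ValuationSubring K} {R : ℕ → Subring K}
  (hq : ∀ i, IsQuadraticTransformAlong O (R i) (R (i + 1))) [∀ i, IsLocalRing (R i)]
  {P : (i : ℕ) → Ideal (R i)} [∀ i, (P i).IsPrime] {N : ℕ}
  (hP𝔪 : ∀ i < N, P i ≠ maximalIdeal (R i))
  (hc : ∀ i < N, (P (i + 1)).comap (Subring.inclusion (hq i).le) = P i)
  {x : (i : ℕ) → R i} (hx0 : ∀ i, x i ≠ 0)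
  (hR : ∀ i, R (i + 1) = locAtCentre (blowupRing (R i) (x i : K)) O)

include hP𝔪 hc hx0 hR in
/-- **Propagation of `ValuationRing`**: if `O` dominates `R 0` and `R 0 ⧸ P 0` is a valuation ring, so is every
`R i ⧸ P i`, `i ≤ N`. OURS. [folklore] -/
theorem valuationRing_quotient_of_seed (h0 : SubringDominates (R 0) O.toSubring)
    (hval0 : ValuationRing (R 0 ⧸ P 0)) : ∀ i ≤ N, ValuationRing (R i ⧸ P i) := by
  intro i hi
  induction i with
  | zero => exact hval0
  | succ i ih =>
    have hiN : i < N := Nat.lt_of_succ_le hi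
    exact valuationRing_quotient_step (hq i) (subringDominates_of_base hq h0 i) (hx0 i) (hR i) (hP𝔪 i hiN)
      (hc i hiN) (ih hiN.le)

include hP𝔪 hc hx0 hR in
/-- **Propagation of regularity of dimension one**: if `O` dominates `R 0` and `R 0 ⧸ P 0` is regular of
dimension one, so is every `R i ⧸ P i`, `i ≤ N` (the residue rings are all isomorphic). OURS. [folklore] -/
theorem isRegularLocalRing_quotient_of_seed (h0 : SubringDominates (R 0) O.toSubring)
    (hreg0 : IsRegularLocalRing (R 0 ⧸ P 0)) (hdim0 : ringKrullDim (R 0 ⧸ P 0) = 1) :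
    ∀ i ≤ N, IsRegularLocalRing (R i ⧸ P i) ∧ ringKrullDim (R i ⧸ P i) = 1 := by
  intro i hi
  induction i with
  | zero => exact ⟨hreg0, hdim0⟩
  | succ i ih =>
    have hiN : i < N := Nat.lt_of_succ_le hi
    obtain ⟨hreg, hdim⟩ := ih hiN.le
    exact isRegularLocalRing_quotient_step (hq i) (subringDominates_of_base hq h0 i) (hx0 i) (hR i)
      (hP𝔪 i hiN) (hc i hiN) hreg hdim

end SequenceSeed

/-! ## §7 The statements, seed form -/

/-- **CurveEscapeBound, core with the weakest residue hypothesis**: as `curveEscapeBound_lt`, but assuming only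
that `R 0 ⧸ P 0` is a VALUATION RING (instead of «`R i ⧸ P i` regular of dimension one for all `i < N`»):
`N < n`. Proof: domination of `R 0` is automatic (part 2's `subringDominates_base`), the valuation-ring property
propagates (`valuationRing_quotient_of_seed`), and part 2's `valuation_le_pow` gives `v u ≤ v z ^ N`. OURS. [folklore] -/
theorem curveEscapeBound_lt_of_valuationRing :
    ∀ (K : Type) [Field K] (O : ValuationSubring K)
      (R : ℕ → Subring K) (hq : ∀ i, IsQuadraticTransformAlong O (R i) (R (i + 1)))
      [∀ i, IsLocalRing (R i)] (P : (i : ℕ) → Ideal (R i)) [∀ i, (P i).IsPrime] (N n : ℕ)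
      (u z : R 0), u ∈ P 0 → u ≠ 0 → (z : K) ≠ 0 → maximalIdeal (R 0) = P 0 ⊔ Ideal.span {z} →
      O.valuation (z : K) ^ n < O.valuation (u : K) →
      (∀ i < N, P i ≠ maximalIdeal (R i)) →
      ValuationRing (R 0 ⧸ P 0) →
      (∀ i < N, (P (i + 1)).comap (Subring.inclusion (hq i).le) = P i) →
      N < n := by
  intro K _ O R hq _ P _ N n u z hu _hu0 _hz0 h𝔪 hlt hP𝔪 hval0 hc
  choose _hloc x hx𝔪 hx0 _hxmax hR using fun i => (hq i).exists_eq_locAtCentre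
  have hvu1 : O.valuation (u : K) ≤ 1 := (O.valuation_le_one_iff _).mpr ((hq 0).source_le u.2)
  have hvz1 : O.valuation (z : K) < 1 := by
    by_contra hge
    have h1 : O.valuation (z : K) = 1 :=
      le_antisymm ((O.valuation_le_one_iff _).mpr ((hq 0).source_le z.2)) (not_lt.mp hge)
    rw [h1, one_pow] at hlt
    exact not_lt.mpr hvu1 hlt
  by_contra hNn
  have hnN : n ≤ N := not_lt.mp hNn
  rcases Nat.eq_zero_or_pos N with hN0 | hNpos
  · subst hN0
    have hn0 : n = 0 := Nat.le_zero.mp hnN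
    rw [hn0, pow_zero] at hlt
    exact not_lt.mpr hvu1 hlt
  · have h0 : SubringDominates (R 0) O.toSubring :=
      subringDominates_base hq hP𝔪 hc hx0 hR hNpos h𝔪.le hvz1
    have hval : ∀ i < N, ValuationRing (R i ⧸ P i) := fun i hi =>
      valuationRing_quotient_of_seed hq hP𝔪 hc hx0 hR h0 hval0 i hi.le
    have hle := valuation_le_pow hq hP𝔪 hc hx𝔪 hx0 hR h0 hval h𝔪.le hu
    have hpow : O.valuation (z : K) ^ N ≤ O.valuation (z : K) ^ n := pow_le_pow_right_of_le_one' hvz1.le hnN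
    exact lt_irrefl _ (lt_of_lt_of_le hlt (hle.trans hpow))

/-- **CurveEscapeBound, seed form, sharp**: as `curveEscapeBound_lt` with «`R 0 ⧸ P 0` regular of dimension
one» in place of «`R i ⧸ P i` regular of dimension one for all `i < N`»: the centre leaves the strict transforms
of a curve regular AT THE START after fewer than `n` steps once `v z ^ n < v u`. OURS; res-L0-w41-plan-1's
engine sanity bound A6 with the regularity check at the start of the window only. [folklore] -/
theorem curveEscapeBound_lt_seed :
    ∀ (K : Type) [Field K] (O : ValuationSubring K)
      (R : ℕ → Subring K) (hq : ∀ i, IsQuadraticTransformAlong O (R i) (R (i + 1)))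
      [∀ i, IsLocalRing (R i)] (P : (i : ℕ) → Ideal (R i)) [∀ i, (P i).IsPrime] (N n : ℕ)
      (u z : R 0), u ∈ P 0 → u ≠ 0 → (z : K) ≠ 0 → maximalIdeal (R 0) = P 0 ⊔ Ideal.span {z} →
      O.valuation (z : K) ^ n < O.valuation (u : K) →
      (∀ i < N, P i ≠ maximalIdeal (R i)) →
      (IsRegularLocalRing (R 0 ⧸ P 0) ∧ ringKrullDim (R 0 ⧸ P 0) = 1) →
      (∀ i < N, (P (i + 1)).comap (Subring.inclusion (hq i).le) = P i) →
      N < n := by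
  intro K _ O R hq _ P _ N n u z hu hu0 hz0 h𝔪 hlt hP𝔪 hreg hc
  haveI := hreg.1
  haveI := isPrincipalIdealRing_of_ringKrullDim_le_one (R := R 0 ⧸ P 0) hreg.2.le
  exact curveEscapeBound_lt_of_valuationRing K O R hq P N n u z hu hu0 hz0 h𝔪 hlt hP𝔪 inferInstance hc

/-- **CurveEscapeBound, seed form**: `N ≤ n`, from `curveEscapeBound_lt_seed`. OURS. [folklore] -/
theorem curveEscapeBound_seed :
    ∀ (K : Type) [Field K] (O : ValuationSubring K)
      (R : ℕ → Subring K) (hq : ∀ i, IsQuadraticTransformAlong O (R i) (R (i + 1)))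
      [∀ i, IsLocalRing (R i)] (P : (i : ℕ) → Ideal (R i)) [∀ i, (P i).IsPrime] (N n : ℕ)
      (u z : R 0), u ∈ P 0 → u ≠ 0 → (z : K) ≠ 0 → maximalIdeal (R 0) = P 0 ⊔ Ideal.span {z} →
      O.valuation (z : K) ^ n < O.valuation (u : K) →
      (∀ i < N, P i ≠ maximalIdeal (R i)) →
      (IsRegularLocalRing (R 0 ⧸ P 0) ∧ ringKrullDim (R 0 ⧸ P 0) = 1) →
      (∀ i < N, (P (i + 1)).comap (Subring.inclusion (hq i).le) = P i) →
      N ≤ n :=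
  fun K _ O R hq _ P _ N n u z hu hu0 hz0 h𝔪 hlt hP𝔪 hreg hc =>
    (curveEscapeBound_lt_seed K O R hq P N n u z hu hu0 hz0 h𝔪 hlt hP𝔪 hreg hc).le

/-- **CurveEscape, seed form**: a valuation ring with ARCHIMEDEAN value group cannot keep its centres on the strict
transforms `P i` (`P (i+1) ∩ R i = P i`, `P i ≠ 𝔪_i`) of ONE curve for ever along a sequence of quadratic
transforms along it, as soon as the curve is non-trivial at the start (`P 0 ≠ ⊥`) and regular of dimension one
at SOME stage `i₀` (instead of at every stage, as in `curveEscape`). Proof: shift the sequence to `i₀`; by KEY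
REMARK 2 (`subringDominates_of_isRegularLocalRing_quotient`, using `P (i₀+1) ≠ 𝔪`) `O` dominates `R i₀`, so
regularity of dimension one propagates to every later stage (`isRegularLocalRing_quotient_of_seed`), `P i ≠ ⊥`
propagates upward (`inclusion_mem_iff`), and `curveEscape` applies to the shifted sequence. OURS. [folklore] -/
theorem curveEscape_seed :
    ∀ (K : Type) [Field K] (O : ValuationSubring K),
      (∀ x y : K, y ≠ 0 → O.valuation x < 1 → ∃ n : ℕ, O.valuation x ^ n < O.valuation y) →
      ∀ (R : ℕ → Subring K) (hq : ∀ i, IsQuadraticTransformAlong O (R i) (R (i + 1)))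
        [∀ i, IsLocalRing (R i)] (P : (i : ℕ) → Ideal (R i)) [∀ i, (P i).IsPrime],
        (∀ i, P i ≠ maximalIdeal (R i)) →
        P 0 ≠ ⊥ →
        (∃ i₀, IsRegularLocalRing (R i₀ ⧸ P i₀) ∧ ringKrullDim (R i₀ ⧸ P i₀) = 1) →
        (∀ i, (P (i + 1)).comap (Subring.inclusion (hq i).le) = P i) →
        False := by
  intro K _ O hArch R hq _ P _ hP𝔪 hP0 hreg hc
  obtain ⟨i₀, hreg₀, hdim₀⟩ := hreg
  choose _hloc x _hx𝔪 hx0 _hxmax hR using fun i => (hq i).exists_eq_locAtCentre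
  -- KEY REMARK 2: `O` dominates the seed ring `R i₀`
  have h0 : SubringDominates (R i₀) O.toSubring :=
    subringDominates_of_isRegularLocalRing_quotient (hq i₀) (hx0 i₀) (hR i₀) (hP𝔪 i₀) (hP𝔪 (i₀ + 1))
      (hc i₀) hreg₀ hdim₀
  -- regularity of dimension one at every stage of the shifted sequence `j ↦ R (i₀ + j)`
  have hreg' : ∀ j, IsRegularLocalRing (R (i₀ + j) ⧸ P (i₀ + j)) ∧ ringKrullDim (R (i₀ + j) ⧸ P (i₀ + j)) = 1 :=
    fun j => isRegularLocalRing_quotient_of_seed (R := fun j => R (i₀ + j)) (fun j => hq (i₀ + j))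
      (P := fun j => P (i₀ + j)) (N := j) (fun j _ => hP𝔪 (i₀ + j)) (fun j _ => hc (i₀ + j))
      (x := fun j => x (i₀ + j)) (fun j => hx0 (i₀ + j)) (fun j => hR (i₀ + j)) h0 hreg₀ hdim₀ j le_rfl
  -- `P (i₀ + j) ≠ ⊥`
  obtain ⟨u, hu, hu0⟩ := Submodule.exists_mem_ne_zero_of_ne_bot hP0
  have hPbot : ∀ j, P (i₀ + j) ≠ ⊥ := by
    intro j hbot
    have h1 : Subring.inclusion (sequence_monotone hq (Nat.zero_le (i₀ + j))) u ∈ P (i₀ + j) :=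
      (inclusion_mem_iff hq (N := i₀ + j) (fun i _ => hc i) (Nat.zero_le _) le_rfl u).mpr hu
    rw [hbot, Ideal.mem_bot] at h1
    apply hu0
    apply Subtype.ext
    have h2 := congrArg (fun w : R (i₀ + j) => (w : K)) h1
    simpa [Subring.coe_inclusion] using h2
  exact curveEscape K O hArch (fun j => R (i₀ + j)) (fun j => hq (i₀ + j)) (fun j => P (i₀ + j))
    (fun j => hP𝔪 (i₀ + j)) hPbot hreg' (fun j => hc (i₀ + j))

end Summit.ResolutionOfSingularities.ResolutionOfSingularities.Theorems.SwitchingDichotomy.CurveEscape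

end
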